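import Mathlib.Analysis.Calculus.MeanValue
import Mathlib.Analysis.SpecialFunctions.Exponential
import Mathlib.Analysis.SpecialFunctions.Trigonometric.Bounds
import Literature.Analysis.Distribution.LaplaceExpSumsCalculus
import HarnessLib

/-!
# The sharp uniform bound for the tail of the imaginary exponential series

Topic `Literature/Analysis/Distribution`, companion of `LaplaceExpSumsCalculus` (which defines
`expI t = e^{it}`, `expTrunc N t = ∑_{l ≤ N} (it)^l/l!`, `expTail N = expI − expTrunc N` and proves
`(expTail (N+1))' = i · expTail N` and the RESTRICTED Lagrange-type bound
`‖expTail N t‖ ≤ 2|t|^{N+1}/(N+1)!` for `2|t| ≤ N + 2` from `Complex.exp_bound'`).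

Here: the bound that holds for EVERY real `t`, with constant `1`,

  `‖e^{it} − ∑_{l ≤ N} (it)^l / l!‖ ≤ |t|^{N+1} / (N+1)!`      (`norm_expTail_le_pow_div_factorial`),

the standard estimate behind the Taylor expansion of characteristic functions: R. Durrett,
*Probability: Theory and Examples* (Wadsworth 1991), Chapter 2, §3.c, display (3.6)
`|e^{ix} − Σ_{m≤n} (ix)^m/m!| ≤ min[|x|^{n+1}/(n+1)!, 2|x|^n/n!]` [Durrett1991] (there by the
integral form of the remainder; also Feller II, Lemma XV.4.1). Proof by induction on
`N`: `expTail N 0 = 0`, `‖(expTail (N+1))'(s)‖ = ‖expTail N s‖ ≤ |s|^{N+1}/(N+1)!`, and Mathlib's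
fencing theorem `image_norm_le_of_norm_deriv_right_le_deriv_boundary` with the barrier
`B(s) = s^{N+2}/(N+2)!` on `[0, |t|]` (for `t < 0` applied to `s ↦ expTail (N+1) (−s)`). Also the
companion `‖expTail N t‖ ≤ 2|t|^N/N!` for `N ≥ 1` (second half of Durrett's `min`), and the base case
`‖e^{it} − 1‖ ≤ |t|` in the file's notation.

Use in the tree: the remainder term of instrument `skeleton_persist.py` v1.2 (cell `ns-blowup`):
for a trigonometric polynomial `G(x) = ∑_k Ĝ_k e^{ik·x}`, `∇G(p + y) − ∇G(p) = ∑_k ik Ĝ_k e^{ik·p}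
(e^{ik·y} − 1)` and the order-`m` Taylor remainder of `e^{ik·y}` is at most `(|k||y|)^{m+1}/(m+1)!`
by this lemma with `t = k·y`.
-/

noncomputable section

open Set Complex
open scoped Nat

namespace Literature.Analysis.Distribution

/-- `expTrunc N 0 = 1` (only the `l = 0` term survives). [folklore] -/
private theorem expTrunc_zero_right (N : ℕ) : expTrunc N 0 = 1 := by
  unfold expTrunc
  rw [Finset.sum_eq_single 0]
  · simp
  · intro l _ hl
    simp [zero_pow hl]
  · simp

/-- `expTail N 0 = 0`. [folklore] -/
private theorem expTail_zero_right (N : ℕ) : expTail N 0 = 0 := by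
  simp [expTail, expI, expTrunc_zero_right]

/-- Base case in the file's notation: `‖e^{it} − 1‖ ≤ |t|`, i.e. `‖expTail 0 t‖ ≤ |t|`
(`Real.norm_exp_I_mul_ofReal_sub_one_le`); the case `n = 0` of [cite: Durrett1991, Ch. 2 §3.c, (3.6)]. -/
theorem norm_expTail_zero_le (t : ℝ) : ‖expTail 0 t‖ ≤ |t| := by
  have h1 : expTail 0 t = cexp (I * (t : ℂ)) - 1 := by
    simp [expTail, expI, expTrunc, mul_comm]
  rw [h1]
  simpa [Real.norm_eq_abs] using Real.norm_exp_I_mul_ofReal_sub_one_le (x := t)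

/-- One induction step on `[0, ∞)`: if `‖expTail N s‖ ≤ |s|^{N+1}/(N+1)!` for all `s`, then
`‖expTail (N+1) t‖ ≤ t^{N+2}/(N+2)!` for `t ≥ 0` (fencing theorem with barrier `s^{N+2}/(N+2)!`). [folklore] -/
private theorem norm_expTail_succ_le_of_nonneg {N : ℕ}
    (ih : ∀ s : ℝ, ‖expTail N s‖ ≤ |s| ^ (N + 1) / ((N + 1)! : ℝ)) {t : ℝ} (ht : 0 ≤ t) :
    ‖expTail (N + 1) t‖ ≤ t ^ (N + 2) / ((N + 2)! : ℝ) := by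
  -- barrier `B(s) = s^{N+2}/(N+2)!`, `B'(s) = s^{N+1}/(N+1)!`
  have hB : ∀ x : ℝ, HasDerivAt (fun s : ℝ => s ^ (N + 2) / ((N + 2)! : ℝ)) (x ^ (N + 1) / ((N + 1)! : ℝ)) x := by
    intro x
    have h := (hasDerivAt_pow (N + 2) x).div_const ((N + 2)! : ℝ)
    refine h.congr_deriv ?_
    have hf : ((N + 2)! : ℝ) = (N + 2) * ((N + 1)! : ℝ) := by
      rw [show N + 2 = (N + 1) + 1 by ring, Nat.factorial_succ]; push_cast; ring
    have hsub : N + 2 - 1 = N + 1 := by omega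
    rw [hf, hsub]
    have hpos : ((N + 1)! : ℝ) ≠ 0 := by exact_mod_cast Nat.factorial_ne_zero _
    have hN2 : ((N : ℝ) + 2) ≠ 0 := by positivity
    push_cast
    field_simp
  have hcont : ContinuousOn (expTail (N + 1)) (Icc 0 t) :=
    (contDiff_expTail (N + 1)).continuous.continuousOn
  have hder : ∀ x ∈ Ico 0 t, HasDerivWithinAt (expTail (N + 1)) (I * expTail N x) (Ici x) x :=
    fun x _ => (hasDerivAt_expTail_succ N x).hasDerivWithinAt
  have h0 : ‖expTail (N + 1) 0‖ ≤ (0 : ℝ) ^ (N + 2) / ((N + 2)! : ℝ) := by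
    rw [expTail_zero_right, norm_zero]; positivity
  have hbound : ∀ x ∈ Ico 0 t, ‖I * expTail N x‖ ≤ x ^ (N + 1) / ((N + 1)! : ℝ) := by
    intro x hx
    rw [norm_mul, Complex.norm_I, one_mul]
    have h := ih x
    rwa [abs_of_nonneg hx.1] at h
  exact image_norm_le_of_norm_deriv_right_le_deriv_boundary hcont hder h0 hB hbound (right_mem_Icc.2 ht)

/-- The reflected step for `t ≤ 0`, via `s ↦ expTail (N+1) (−s)` on `[0, −t]`. [folklore] -/
private theorem norm_expTail_succ_le_of_nonpos {N : ℕ}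
    (ih : ∀ s : ℝ, ‖expTail N s‖ ≤ |s| ^ (N + 1) / ((N + 1)! : ℝ)) {t : ℝ} (ht : t ≤ 0) :
    ‖expTail (N + 1) t‖ ≤ |t| ^ (N + 2) / ((N + 2)! : ℝ) := by
  set g : ℝ → ℂ := fun s => expTail (N + 1) (-s) with hg
  have hB : ∀ x : ℝ, HasDerivAt (fun s : ℝ => s ^ (N + 2) / ((N + 2)! : ℝ)) (x ^ (N + 1) / ((N + 1)! : ℝ)) x := by
    intro x
    have h := (hasDerivAt_pow (N + 2) x).div_const ((N + 2)! : ℝ)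
    refine h.congr_deriv ?_
    have hf : ((N + 2)! : ℝ) = (N + 2) * ((N + 1)! : ℝ) := by
      rw [show N + 2 = (N + 1) + 1 by ring, Nat.factorial_succ]; push_cast; ring
    have hsub : N + 2 - 1 = N + 1 := by omega
    rw [hf, hsub]
    have hpos : ((N + 1)! : ℝ) ≠ 0 := by exact_mod_cast Nat.factorial_ne_zero _
    have hN2 : ((N : ℝ) + 2) ≠ 0 := by positivity
    push_cast
    field_simp
  have hcont : ContinuousOn g (Icc 0 (-t)) :=
    ((contDiff_expTail (N + 1)).continuous.comp continuous_neg).continuousOn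
  have hder : ∀ x ∈ Ico 0 (-t), HasDerivWithinAt g (-(I * expTail N (-x))) (Ici x) x := by
    intro x _
    have h := (hasDerivAt_expTail_succ N (-x)).scomp x (hasDerivAt_neg x)
    have h' : HasDerivAt g (-(I * expTail N (-x))) x := by
      simpa [hg, Function.comp_def] using h
    exact h'.hasDerivWithinAt
  have h0 : ‖g 0‖ ≤ (0 : ℝ) ^ (N + 2) / ((N + 2)! : ℝ) := by
    simp only [hg, neg_zero, expTail_zero_right, norm_zero]; positivity
  have hbound : ∀ x ∈ Ico 0 (-t), ‖-(I * expTail N (-x))‖ ≤ x ^ (N + 1) / ((N + 1)! : ℝ) := by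
    intro x hx
    rw [norm_neg, norm_mul, Complex.norm_I, one_mul]
    have h := ih (-x)
    rwa [abs_neg, abs_of_nonneg hx.1] at h
  have hmain := image_norm_le_of_norm_deriv_right_le_deriv_boundary hcont hder h0 hB hbound
    (right_mem_Icc.2 (neg_nonneg.2 ht))
  have hgt : g (-t) = expTail (N + 1) t := by simp [hg]
  rw [hgt] at hmain
  rwa [abs_of_nonpos ht]

/-- **Sharp uniform bound for the tail of the imaginary exponential series**: for every `N` and every
real `t`, `‖e^{it} − ∑_{l ≤ N} (it)^l/l!‖ ≤ |t|^{N+1}/(N+1)!` — the first bound of Durrett's (3.6)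
(proved here by induction and Mathlib's fencing theorem instead of the integral remainder). Improves
`norm_expTail_le` (constant `2`, hypothesis `2|t| ≤ N + 2`). [cite: Durrett1991, Ch. 2 §3.c, (3.6)] -/
theorem norm_expTail_le_pow_div_factorial (N : ℕ) (t : ℝ) :
    ‖expTail N t‖ ≤ |t| ^ (N + 1) / ((N + 1)! : ℝ) := by
  induction N generalizing t with
  | zero => simpa using norm_expTail_zero_le t
  | succ N ih =>
    rcases le_total 0 t with ht | ht
    · have h := norm_expTail_succ_le_of_nonneg ih ht
      rwa [abs_of_nonneg ht]
    · exact norm_expTail_succ_le_of_nonpos ih ht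

/-- The same in exponential notation: `‖exp(it) − ∑_{l<N+1} (it)^l/l!‖ ≤ |t|^{N+1}/(N+1)!`. [cite: Durrett1991, Ch. 2 §3.c, (3.6)] -/
theorem norm_exp_mul_I_sub_sum_le (N : ℕ) (t : ℝ) :
    ‖cexp ((t : ℂ) * I) - ∑ l ∈ Finset.range (N + 1), ((t : ℂ) * I) ^ l / (l ! : ℂ)‖ ≤
      |t| ^ (N + 1) / ((N + 1)! : ℝ) :=
  norm_expTail_le_pow_div_factorial N t

/-- Second half of Durrett's `min`: `‖expTail (N+1) t‖ ≤ 2|t|^{N+1}/(N+1)!` for all `t` (one more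
term of the series costs at most `|t|^{N+1}/(N+1)!`) — the second bound of (3.6) with `n = N + 1`. [cite: Durrett1991, Ch. 2 §3.c, (3.6)] -/
theorem norm_expTail_succ_le_two_mul (N : ℕ) (t : ℝ) :
    ‖expTail (N + 1) t‖ ≤ 2 * |t| ^ (N + 1) / ((N + 1)! : ℝ) := by
  have hsplit : expTail (N + 1) t = expTail N t - ((t : ℂ) * I) ^ (N + 1) / ((N + 1)! : ℂ) := by
    simp only [expTail, expTrunc, Finset.sum_range_succ]
    ring
  have hterm : ‖((t : ℂ) * I) ^ (N + 1) / ((N + 1)! : ℂ)‖ = |t| ^ (N + 1) / ((N + 1)! : ℝ) := by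
    rw [norm_div, norm_pow, norm_mul, Complex.norm_real, Complex.norm_I, mul_one, Real.norm_eq_abs]
    congr 1
    rw [Complex.norm_natCast]
  calc ‖expTail (N + 1) t‖ = ‖expTail N t - ((t : ℂ) * I) ^ (N + 1) / ((N + 1)! : ℂ)‖ := by rw [hsplit]
    _ ≤ ‖expTail N t‖ + ‖((t : ℂ) * I) ^ (N + 1) / ((N + 1)! : ℂ)‖ := norm_sub_le _ _
    _ ≤ |t| ^ (N + 1) / ((N + 1)! : ℝ) + |t| ^ (N + 1) / ((N + 1)! : ℝ) := by
        rw [hterm]; exact add_le_add (norm_expTail_le_pow_div_factorial N t) le_rfl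
    _ = 2 * |t| ^ (N + 1) / ((N + 1)! : ℝ) := by ring

end Literature.Analysis.Distribution

end
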